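import Literature.NumberTheory.EllipticCurves.ZpExtensionEisensteinDVRSetting
import HarnessLib

/-!
# The Eisenstein `DVRSetting` of the curve: the residual presentations are compatible along the tower (`πbar_red`)

Topic `NumberTheory/EllipticCurves` (D1 road of cell `pub/bsd-print-x9`; companion of `ZpExtensionEisensteinDVRSetting`).
THEOREMS ONLY; no definition, no named fact, no instance, no notation, no `sorry`.

The field `πbar_red` of `DVRSetting.SatisfiesH` (part B of the cell's (W9), clause H.1: «residual presentation
`T^{(k)} ↠ T̄ = T/𝔪T`», the presentations of consecutive levels agreeing along the reduction) for the curve's Eisenstein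
setting `S := W.eisensteinDVRSetting κ hm S hpS hbad L hL hLS jbar cd D fs`: the pinned presentations
`π̄_k : E_K[p^{k+1}] ⊗ A_{m,k+1} ↠ E_K[p]`, `π̄_k(1 ⊗ P) = p^k P` (`coe_eisensteinDVRSetting_πbar_tmul`), satisfy
**`π̄_k ∘ red_k = π̄_{k+1}`** (`eisensteinDVRSetting_πbar_red`): on a pure tensor `[F] ⊗ P` both sides are
`F(0) · p^{k+1} P` (`A_{m,·}` acts on `E_K[p]` through the residue character `residueChar`, `reduce [F] = [F]`).
The statement carries the CONSUMER PREAMBLE of `ZpExtensionEisensteinDVRSetting`.  BSD is not proved by any of this.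

References: [Howard2004HeegnerKolyvagin] §1.3 H.1 (arXiv:1202.6340 p. 7 L59), §1.6 (p. 11 L13–38), proof of Prop. 2.1.3
(`T̄ ≅ E[p] ⊗ S/𝔪`); [SilvermanAEC2009] III.§7.
-/

set_option autoImplicit false

noncomputable section

open Function NumberField IsDedekindDomain Field
open scoped NumberField ContRepresentation TensorProduct Classical

namespace WeierstrassCurve

open Literature.NumberTheory.EllipticCurves Literature.NumberTheory.GaloisRepresentations
open Literature.NumberTheory.GaloisRepresentations.DiscreteGaloisModule
open Literature.NumberTheory.GaloisCohomology.Howard2004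
open Literature.NumberTheory.EllipticCurves.ZpExtension (EisensteinLevel)

variable {K : Type} [Field K] [NumberField K] (W : WeierstrassCurve ℚ) [W.IsElliptic] {p : ℕ} [hp : Fact p.Prime]
  (κ : ZpExtension K p) {m : ℕ} (hm : 1 ≤ m)
  (S : Finset (HeightOneSpectrum (𝓞 K)))
  (hpS : ∀ v : HeightOneSpectrum (𝓞 K), ((p : ℕ) : 𝓞 K) ∈ v.asIdeal → v ∈ S)
  (hbad : ∀ v : HeightOneSpectrum (𝓞 K), v ∉ S → ((p : ℕ) : 𝓞 K) ∉ v.asIdeal → (W.baseChange K).HasGoodReductionAt v)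
  (L : Set (HeightOneSpectrum (𝓞 K)))
  (hL : letI := IwasawaAlgebra.isLocalRing_quotient_X_pow_add_C p hm
    L ⊆ (W.eisensteinTower κ hm).degreeTwoPrimes p)
  (hLS : ∀ v ∈ L, v ∉ S)
  (jbar : AlgebraicClosure K →+* ℂ) (cd : ConjugationDatum K)
  (D : letI := IwasawaAlgebra.isLocalRing_quotient_X_pow_add_C p hm
    ∀ k, DualityDatum p cd ((W.eisensteinTower κ hm).ρ k) (IwasawaAlgebra.EisensteinCoeff p m (k + 1)))
  (fs : letI := IwasawaAlgebra.isLocalRing_quotient_X_pow_add_C p hm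
    ∀ (k : ℕ) (n : Finset (HeightOneSpectrum (𝓞 K))) (v : HeightOneSpectrum (𝓞 K)),
      galoisCohomology ((W.eisensteinLevelQuot κ hm k n).toLocal (Sum.inr v)) 1 →+
        SingularQuotient (GaloisRep.toLocal v (W.eisensteinLevelQuot κ hm k n)) ⊗[ℤ] Gell v)

set_option synthInstance.maxHeartbeats 80000 in
/-- **The residual presentation on an arbitrary pure tensor: `π̄_k(c ⊗ P) = ε(c) · p^k P`**, `ε` the residue character
of `A_{m,k+1}` (the `A_{m,k+1}`-linearity of `π̄_k` for `residueModule` and `coe_eisensteinDVRSetting_πbar_tmul`).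
[cite: Howard2004HeegnerKolyvagin, proof of Prop. 2.1.3 (T̄ ≅ E[p] ⊗ S/𝔪, the action on the second factor trivial)] -/
theorem coe_eisensteinDVRSetting_πbar_tmul' (k : ℕ) (c : IwasawaAlgebra.EisensteinCoeff p m (k + 1))
    (P : geomTorsion (W.baseChange K) ((p : ℤ) ^ (k + 1))) :
    letI := IwasawaAlgebra.isDomain_quotient_X_pow_add_C p hm
    letI := IwasawaAlgebra.isDiscreteValuationRing_quotient_X_pow_add_C p hm
    haveI := IwasawaAlgebra.EisensteinCoeff.isLocalRing_succ p hm
    letI := IwasawaAlgebra.EisensteinCoeff.algebraOfSpecSucc p m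
    haveI := W.isScalarTower_algebraOfSpecSucc (K := K) (p := p) (m := m)
    letI := W.residueModuleSucc (K := K) (p := p) hm
    (((W.eisensteinDVRSetting κ hm S hpS hbad L hL hLS jbar cd D fs).πbar k
        (IwasawaAlgebra.EisensteinCoeff.Twisted.tmul c P) : geomTorsion (W.baseChange K) (p : ℤ)) :
        geomPoints (W.baseChange K)) =
      (IwasawaAlgebra.EisensteinCoeff.residueChar p hm k.succ_pos c).val • (((p : ℤ) ^ k) • (P : geomPoints (W.baseChange K))) := by
  letI := IwasawaAlgebra.isDomain_quotient_X_pow_add_C p hm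
  letI := IwasawaAlgebra.isDiscreteValuationRing_quotient_X_pow_add_C p hm
  haveI := IwasawaAlgebra.EisensteinCoeff.isLocalRing_succ p hm
  letI := IwasawaAlgebra.EisensteinCoeff.algebraOfSpecSucc p m
  haveI := W.isScalarTower_algebraOfSpecSucc (K := K) (p := p) (m := m)
  letI := W.residueModuleSucc (K := K) (p := p) hm
  have h1 : (W.eisensteinDVRSetting κ hm S hpS hbad L hL hLS jbar cd D fs).πbar k (IwasawaAlgebra.EisensteinCoeff.Twisted.tmul c P) =
      c • (W.eisensteinDVRSetting κ hm S hpS hbad L hL hLS jbar cd D fs).πbar k (IwasawaAlgebra.EisensteinCoeff.Twisted.tmul 1 P) :=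
    (congrArg ((W.eisensteinDVRSetting κ hm S hpS hbad L hL hLS jbar cd D fs).πbar k) (IwasawaAlgebra.EisensteinCoeff.Twisted.tmul_eq_smul_tmul_one c P)).trans
      (map_smul ((W.eisensteinDVRSetting κ hm S hpS hbad L hL hLS jbar cd D fs).πbar k) c _)
  rw [h1, IwasawaAlgebra.EisensteinCoeff.residueModule_smul p hm k.succ_pos _ c, AddSubmonoidClass.coe_nsmul,
    W.coe_eisensteinDVRSetting_πbar_tmul κ hm S hpS hbad L hL hLS jbar cd D fs k P]

set_option synthInstance.maxHeartbeats 80000 in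
/-- **`SatisfiesH.πbar_red` for the Eisenstein setting: `π̄_k ∘ red_k = π̄_{k+1}`** — the pinned residual presentations
of consecutive levels agree along the reduction `T^{(k+1)} ↠ T^{(k)}` (on `[F] ⊗ P` both give `F(0) · p^{k+1} P`).
[cite: Howard2004HeegnerKolyvagin, §1.3 H.1 (arXiv p. 7, L59) and §1.6 (arXiv p. 11, L33–38); proof of Prop. 2.1.3] -/
theorem eisensteinDVRSetting_πbar_red (k : ℕ)
    (y : IwasawaAlgebra.EisensteinCoeff.Twisted p m (k + 1 + 1) (geomTorsion (W.baseChange K) ((p : ℤ) ^ (k + 1 + 1)))) :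
    letI := IwasawaAlgebra.isDomain_quotient_X_pow_add_C p hm
    letI := IwasawaAlgebra.isDiscreteValuationRing_quotient_X_pow_add_C p hm
    haveI := IwasawaAlgebra.EisensteinCoeff.isLocalRing_succ p hm
    letI := IwasawaAlgebra.EisensteinCoeff.algebraOfSpecSucc p m
    haveI := W.isScalarTower_algebraOfSpecSucc (K := K) (p := p) (m := m)
    letI := W.residueModuleSucc (K := K) (p := p) hm
    (W.eisensteinDVRSetting κ hm S hpS hbad L hL hLS jbar cd D fs).πbar k ((W.eisensteinDVRSetting κ hm S hpS hbad L hL hLS jbar cd D fs).T.red k y) = (W.eisensteinDVRSetting κ hm S hpS hbad L hL hLS jbar cd D fs).πbar (k + 1) y := by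
  letI := IwasawaAlgebra.isDomain_quotient_X_pow_add_C p hm
  letI := IwasawaAlgebra.isDiscreteValuationRing_quotient_X_pow_add_C p hm
  haveI := IwasawaAlgebra.EisensteinCoeff.isLocalRing_succ p hm
  letI := IwasawaAlgebra.EisensteinCoeff.algebraOfSpecSucc p m
  haveI := W.isScalarTower_algebraOfSpecSucc (K := K) (p := p) (m := m)
  letI := W.residueModuleSucc (K := K) (p := p) hm
  induction y using IwasawaAlgebra.EisensteinCoeff.Twisted.induction_on with
  | zero =>
    change (W.eisensteinDVRSetting κ hm S hpS hbad L hL hLS jbar cd D fs).πbar k ((W.eisensteinDVRSetting κ hm S hpS hbad L hL hLS jbar cd D fs).T.red k (0 : EisensteinLevel p m (fun j ↦ geomTorsion (W.baseChange K) ((p : ℤ) ^ j)) (k + 1 + 1))) =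
      (W.eisensteinDVRSetting κ hm S hpS hbad L hL hLS jbar cd D fs).πbar (k + 1) (0 : EisensteinLevel p m (fun j ↦ geomTorsion (W.baseChange K) ((p : ℤ) ^ j)) (k + 1 + 1))
    rw [map_zero, map_zero, map_zero]
  | add x y hx hy =>
    calc (W.eisensteinDVRSetting κ hm S hpS hbad L hL hLS jbar cd D fs).πbar k ((W.eisensteinDVRSetting κ hm S hpS hbad L hL hLS jbar cd D fs).T.red k (x + y))
        = (W.eisensteinDVRSetting κ hm S hpS hbad L hL hLS jbar cd D fs).πbar k ((W.eisensteinDVRSetting κ hm S hpS hbad L hL hLS jbar cd D fs).T.red k x + (W.eisensteinDVRSetting κ hm S hpS hbad L hL hLS jbar cd D fs).T.red k y) := congrArg _ (map_add ((W.eisensteinDVRSetting κ hm S hpS hbad L hL hLS jbar cd D fs).T.red k) x y)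
      _ = (W.eisensteinDVRSetting κ hm S hpS hbad L hL hLS jbar cd D fs).πbar k ((W.eisensteinDVRSetting κ hm S hpS hbad L hL hLS jbar cd D fs).T.red k x) + (W.eisensteinDVRSetting κ hm S hpS hbad L hL hLS jbar cd D fs).πbar k ((W.eisensteinDVRSetting κ hm S hpS hbad L hL hLS jbar cd D fs).T.red k y) := map_add _ _ _
      _ = (W.eisensteinDVRSetting κ hm S hpS hbad L hL hLS jbar cd D fs).πbar (k + 1) x + (W.eisensteinDVRSetting κ hm S hpS hbad L hL hLS jbar cd D fs).πbar (k + 1) y := by rw [hx, hy]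
      _ = (W.eisensteinDVRSetting κ hm S hpS hbad L hL hLS jbar cd D fs).πbar (k + 1) (x + y) := (map_add ((W.eisensteinDVRSetting κ hm S hpS hbad L hL hLS jbar cd D fs).πbar (k + 1)) x y).symm
  | tmul c P =>
    obtain ⟨F, rfl⟩ := Ideal.Quotient.mk_surjective c
    have hred : (W.eisensteinDVRSetting κ hm S hpS hbad L hL hLS jbar cd D fs).T.red k (IwasawaAlgebra.EisensteinCoeff.Twisted.tmul (Ideal.Quotient.mk _ F) P) =
        IwasawaAlgebra.EisensteinCoeff.Twisted.tmul
          (Ideal.Quotient.mk _ F : IwasawaAlgebra.EisensteinCoeff p m (k + 1))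
          ((W.baseChange K).torsionGaloisModuleReduce p (k + 1) P) := by
      rw [← IwasawaAlgebra.EisensteinCoeff.reduce_mk m (Nat.le_succ (k + 1)) F]
      exact κ.eisensteinTwistReduce_tmul hm (Nat.le_succ (k + 1)) ((W.baseChange K).torsionGaloisModuleReduce p (k + 1))
        (Ideal.Quotient.mk _ F) P
    apply Subtype.ext
    rw [hred, W.coe_eisensteinDVRSetting_πbar_tmul' κ hm S hpS hbad L hL hLS jbar cd D fs k,
      W.coe_eisensteinDVRSetting_πbar_tmul' κ hm S hpS hbad L hL hLS jbar cd D fs (k + 1),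
      IwasawaAlgebra.EisensteinCoeff.residueChar_mk, IwasawaAlgebra.EisensteinCoeff.residueChar_mk,
      coe_torsionGaloisModuleReduce, smul_smul, ← pow_succ]

end WeierstrassCurve

end
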